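import Mathlib
import HarnessLib
import Summits.NavierStokesRegularity.NavierStokesRegularity.Theorems.TypeILiouvilleLambTailLogDial

/-!
# TypeILiouvilleLambTailLogLipschitz — crux (L) stmt-NavierStokesRegularity-10661 `TypeIliouvilleL`:
# THE GRADIENT AND VORTICITY DIALS OF PRINT'S CLASS ARE LOG-EQUIVALENT (part 10 of `TypeILiouvilleLambTail`)

Helper for stmt-NavierStokesRegularity-10661 (`--supports`); theorems only, no definitions, no named-fact
hypotheses; closes no item; Navier–Stokes regularity is NOT proved here (leafhand seat of the EulerZoomLiouville route).

Class P (`‖v‖ ≤ K` on `(−∞,0) × ℝ³`, continuous, weakly divergence free, Oseen-mild), `ω = curl v`.  The tree's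
rate-free dictionary (`TypeILiouvilleQuiescentGradient`, `TypeILiouvilleQuiescentVorticity`, by compactness):
quiescent ⟺ `sup‖∇v(τ)‖ → 0` ⟺ `sup‖ω(τ)‖ → 0`.  Part 9's log-Lipschitz dial (`classP_norm_fderiv_le_log`, the
tree's Beale–Kato–Majda estimate with local energy rescaled on the bounded class) makes the second equivalence
QUANTITATIVE, slice by slice, with the loss of exactly one logarithm:

* `classP_norm_fderiv_le_curl_log` — ★ **THE LOG-LIPSCHITZ GRADIENT-BY-VORTICITY BOUND ON PRINT'S CLASS**: there is
  `C = C(v) ≥ 0` with `sup_x ‖∇v(τ,x)‖ ≤ C Ω (1 + log(1/Ω))` on every slice `τ < 0` with `sup_x ‖ω(τ,x)‖ ≤ Ω ≤ 1`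
  (scales `r = (K+1)/Ω`, `δ = Ω²`, Hölder constant `(2Ω(4 + D₂))^{1/2}`).  This is the estimate asked for by the
  previous hand's census («log-Lipschitz/Biot–Savart bound `sup‖∇v(τ)‖ ≲ sup‖ω(τ)‖(1 + log⁺ …)` on class P»); the
  converse `‖ω‖ ≤ ‖curl‖ ‖∇v‖` is pointwise.  Consequently every RATE statement about the vorticity dial of L_Q
  transfers to the gradient/strain dials of the strain ledger (`TypeILiouvilleStrainLedger…`) up to a logarithm, and
  conversely without loss.
* `classP_norm_fderiv_le_of_curl_decay` — the transfer for an arbitrary vorticity majorant `Ω(τ) ≤ 1`: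
  `‖∇v(τ,x)‖ ≤ C Ω(τ)(1 + log(1/Ω(τ)))`.

HONEST LABEL: classical potential estimates; nothing here proves a registered stub, (L), or NS regularity; rung 0.
[cite: MajdaBertozziCUP2002, §3.3 Prop. 3.8, (3.87)] [cite: KochNadirashviliSereginSverak2009, §4 (i), Lemma 6.1 (arXiv:0709.3599)]
-/

noncomputable section
open MeasureTheory Filter Set Function Metric
open scoped Topology ENNReal NNReal RealInnerProductSpace Laplacian ContDiff
open Literature.Analysis Literature.Analysis.FluidPDE Literature.Analysis.UnboundedOperators
set_option linter.dupNamespace false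
namespace Summit.NavierStokesRegularity.NavierStokesRegularity.Theorems.TypeILiouvilleLambTail

/-- ★ **THE LOG-LIPSCHITZ GRADIENT-BY-VORTICITY BOUND ON PRINT'S CLASS.**  For a class-P flow there is `C ≥ 0` such
that on every slice `τ < 0`: `sup_y ‖ω(τ,y)‖ ≤ Ω`, `0 < Ω ≤ 1` ⟹ `‖∇v(τ,x)‖ ≤ C Ω (1 + log(1/Ω))` for all `x`.
Part 9's dial at `r = (K+1)/Ω`, `δ = Ω²`, with the interpolated `½`-Hölder constant `(2Ω(4 + D₂))^{1/2}` of the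
vorticity slice. [cite: MajdaBertozziCUP2002, §3.3 Prop. 3.8, (3.87)] [cite: KochNadirashviliSereginSverak2009, §4 (arXiv:0709.3599)] -/
theorem classP_norm_fderiv_le_curl_log
    {v : ℝ → EuclideanSpace ℝ (Fin 3) → EuclideanSpace ℝ (Fin 3)}
    (hc : ContinuousOn (uncurry v) (Iio 0 ×ˢ univ))
    (hK : ∃ K : ℝ, ∀ t < 0, ∀ x, ‖v t x‖ ≤ K)
    (hd : ∀ t < 0, IsWeaklyDivFree (v t))
    (hm : ∀ s t : ℝ, s < t → t < 0 → ∀ x,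
      v t x = heatExtension (v s) (t - s) x - oseenDuhamel 1 s v v t x) :
    ∃ C : ℝ, 0 ≤ C ∧ ∀ τ < 0, ∀ Ω : ℝ, 0 < Ω → Ω ≤ 1 → (∀ y, ‖curl (v τ) y‖ ≤ Ω) →
      ∀ x, ‖fderiv ℝ (v τ) x‖ ≤ C * Ω * (1 + Real.log (1 / Ω)) := by
  obtain ⟨K, hKb⟩ := hK
  have hK0 : 0 ≤ K := (norm_nonneg _).trans (hKb (-1) (by norm_num) 0)
  obtain ⟨D₂, hD₂0, hH⟩ := classP_holderHalf_curl_of_curl_le hc ⟨K, hKb⟩ hd hm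
  obtain ⟨C, hC0, hLog⟩ := classP_norm_fderiv_le_log hc hKb hd hm
  set H₁ : ℝ := Real.sqrt (2 * (K + 1) * (4 + D₂)) with hH₁
  have hH₁0 : 0 ≤ H₁ := Real.sqrt_nonneg _
  refine ⟨C * (H₁ + 2), by positivity, fun τ hτ Ω hΩ hΩ1 hω x => ?_⟩
  -- Hölder constant of the slice
  have hHτ := hH τ hτ Ω 1 hΩ.le hΩ1 hω
  -- scales `r = (K+1)/Ω`, `δ = Ω²`
  have hr : 0 < (K + 1) / Ω := by positivity
  have hδ : 0 < Ω ^ 2 := by positivity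
  have hδ1 : Ω ^ 2 ≤ 1 := by nlinarith
  have h := hLog τ hτ _ Ω (Real.sqrt_nonneg _) hΩ.le hHτ hω _ hr _ hδ hδ1 x
  -- simplify the terms
  have e1 : ((K + 1) / Ω) ^ (1 / 2 : ℝ) * Real.sqrt (2 * Ω * (4 * 1 + D₂)) = H₁ := by
    rw [← Real.sqrt_eq_rpow, ← Real.sqrt_mul hr.le, hH₁]
    congr 1
    field_simp
  have e2 : (Ω ^ 2) ^ (1 / 2 : ℝ) = Ω := by
    rw [← Real.sqrt_eq_rpow, Real.sqrt_sq hΩ.le]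
  have e3 : Real.log (1 / Ω ^ 2) = 2 * Real.log (1 / Ω) := by
    rw [one_div, one_div, Real.log_inv, Real.log_inv, Real.log_pow]; push_cast; ring
  rw [e1, e2, e3] at h
  have hlog0 : 0 ≤ Real.log (1 / Ω) := Real.log_nonneg ((one_le_div hΩ).2 hΩ1)
  have e4 : K / ((K + 1) / Ω) ≤ Ω := by
    rw [div_div_eq_mul_div, div_le_iff₀ (by positivity)]
    nlinarith
  calc ‖fderiv ℝ (v τ) x‖ ≤ C * ((H₁ + Ω) * Ω + Ω * (2 * Real.log (1 / Ω)) + K / ((K + 1) / Ω)) := h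
    _ ≤ C * ((H₁ + 1) * Ω + Ω * (2 * Real.log (1 / Ω)) + Ω) := by
        refine mul_le_mul_of_nonneg_left ?_ hC0
        have : (H₁ + Ω) * Ω ≤ (H₁ + 1) * Ω := mul_le_mul_of_nonneg_right (by linarith) hΩ.le
        linarith
    _ = C * Ω * (H₁ + 2 + 2 * Real.log (1 / Ω)) := by ring
    _ ≤ C * (H₁ + 2) * Ω * (1 + Real.log (1 / Ω)) := by
        have h1 : H₁ + 2 + 2 * Real.log (1 / Ω) ≤ (H₁ + 2) * (1 + Real.log (1 / Ω)) := by
          nlinarith [mul_nonneg hH₁0 hlog0]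
        have h2 : 0 ≤ C * Ω := mul_nonneg hC0 hΩ.le
        calc C * Ω * (H₁ + 2 + 2 * Real.log (1 / Ω)) ≤ C * Ω * ((H₁ + 2) * (1 + Real.log (1 / Ω))) :=
              mul_le_mul_of_nonneg_left h1 h2
          _ = C * (H₁ + 2) * Ω * (1 + Real.log (1 / Ω)) := by ring

/-- **Transfer of an arbitrary vorticity rate to the gradient dial, up to a logarithm.**  If
`sup_x ‖ω(τ,x)‖ ≤ Ω(τ)` with `0 < Ω(τ) ≤ 1` on `(−∞,0)`, then `‖∇v(τ,x)‖ ≤ C Ω(τ) (1 + log(1/Ω(τ)))` on `(−∞,0) × ℝ³`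
(with the converse `‖ω(τ,x)‖ ≤ ‖curl‖ ‖∇v(τ,x)‖` pointwise: the two dials of L_Q are log-equivalent).
[cite: MajdaBertozziCUP2002, §3.3 Prop. 3.8, (3.87)] [cite: KochNadirashviliSereginSverak2009, §4 (arXiv:0709.3599)] -/
theorem classP_norm_fderiv_le_of_curl_decay
    {v : ℝ → EuclideanSpace ℝ (Fin 3) → EuclideanSpace ℝ (Fin 3)}
    (hc : ContinuousOn (uncurry v) (Iio 0 ×ˢ univ))
    (hK : ∃ K : ℝ, ∀ t < 0, ∀ x, ‖v t x‖ ≤ K)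
    (hd : ∀ t < 0, IsWeaklyDivFree (v t))
    (hm : ∀ s t : ℝ, s < t → t < 0 → ∀ x,
      v t x = heatExtension (v s) (t - s) x - oseenDuhamel 1 s v v t x)
    {Ω : ℝ → ℝ} (hΩ0 : ∀ τ < 0, 0 < Ω τ) (hΩ1 : ∀ τ < 0, Ω τ ≤ 1)
    (hω : ∀ τ < 0, ∀ x : EuclideanSpace ℝ (Fin 3), ‖curl (v τ) x‖ ≤ Ω τ) :
    ∃ C : ℝ, 0 ≤ C ∧ ∀ τ < 0, ∀ x : EuclideanSpace ℝ (Fin 3),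
      ‖fderiv ℝ (v τ) x‖ ≤ C * Ω τ * (1 + Real.log (1 / Ω τ)) ∧
        ‖curl (v τ) x‖ ≤ ‖curlCLM‖ * ‖fderiv ℝ (v τ) x‖ := by
  obtain ⟨C, hC0, hCv⟩ := classP_norm_fderiv_le_curl_log hc hK hd hm
  refine ⟨C, hC0, fun τ hτ x => ⟨hCv τ hτ (Ω τ) (hΩ0 τ hτ) (hΩ1 τ hτ) (hω τ hτ) x, ?_⟩⟩
  exact ContinuousLinearMap.le_opNorm curlCLM (fderiv ℝ (v τ) x)

end Summit.NavierStokesRegularity.NavierStokesRegularity.Theorems.TypeILiouvilleLambTail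

end
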